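import Summits.CriticalPhenomena.PercolationContinuityZ3.Theorems.PercNearOneGluingNoHeavyQuantSubproductMixture
import HarnessLib

/-!
# QUANT lane R8, T-DEC: `k` IDENTICAL SIBLINGS WITH `(k−1)·q ≤ 1` SATISFY THE SIBLING STEP AT THE TRUE FLOOR, EVERY `k ≥ 3`, EVERY SUB-TREE —
# the closed-form sub-product certificate (boosted `(k−1)`-sets + fully opened `s`-sets) fed to the sub-product mixture criterion

builds on p205010 (kernel theorem, internal audit signed; external expert review pending)

Support file (`--supports stmt-CriticalPhenomena-4575`), QUANT lane seat prim-quant-census-1 (gen 26), rung R8 of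
`run/shared/lean/prim/quant/LADDER.md`; memo `run/shared/lean/prim/quant/prim-quant-census-1/g26/SIZEBIAS-G26.md` §7.  Theorems only, standard axioms,
no sorries.  An INSTANCE, for every width, of ✓ `…QuantSubproductMixture` (`sdec_flaw_of_subproductMix`, p503068).

THE CERTIFICATE (memo §7; found from the exact LP frontier `(k−1)q ≤ 1` of the census, `k = 3, 4, 5`, then in closed form).  `k` copies of a tree-built
sibling `s` (root gate `q`, opened mean `m`, opened floor `x₁`), `D = (k−1)(k − 2(k−1)q) > 0`:
* (Q) for every ORDERED pair `(d, j)`, `d ≠ j`: the sub-forest `[k] ∖ {d}` with sibling `j` BOOSTED to openness `2q` and the other `k − 2` at `q`;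
  weight `u_Q = (1−q)²/D`; gated mean `((k−2)q + 2q)·m = kqm = fmean` exactly; floor tight;
* (O_B) for every subset `B` with `2 ≤ |B|`: `B` FULLY OPENED; weight `u_B = q^{|B|}(1−q)^{k−|B|}(|B|−1)(|B| − 2(k−1)q)/D` for `|B| < k`, `u_{[k]} = q^k`;
  gated mean `|B|·m ≥ kqm`.
PATTERN IDENTITY (`Σ_c u_c P_c(A) = q^{|A|}(1−q)^{k−|A|}`, all `A ≠ ∅`): the O-components charge only their own set; for `|A| = s < k` the Q-components give
`(k−s)·u_Q·q^s(1−q)^{k−1−s}·[2s + (k−1−s)(1−2q)/(1−q)]` (`prod_boost`, `prod_one_sub_boost`, `sum_two_or_r`: choose the dropped `d ∉ A`, then the boosted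
`j ∈ A` or `j ∉ A`), and `(k−s)[2s(1−q) + (k−1−s)(1−2q)] + (s−1)(s − 2(k−1)q) = (k−1)(k − 2(k−1)q)` is `ring`.  SIGNS: all weights `≥ 0` iff `(k−1)q ≤ 1`
(the open PAIR binds) — EXACTLY the LP frontier of mean-certified sub-forest mixtures on identical siblings (memo §5), so this family is the full reach of the
method there.  `k = 3` (`q ≤ 1/2`) is arm-1 g53's ✓ `sdec_symTriple_trueFloor` (p503171, a three-component symmetrisation); `k·q ≤ 1` is census-1 g26's
size-bias corollary `sdec_flaw_replicate_of_oracle` (p500581).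

* **`sdec_flaw_replicate_of_subproductMix`**: `0 < x < 1`, `s.TreeOK x`, `3 ≤ k`, `(k−1)·s.q ≤ 1`, the oracle below `fgates (replicate k s)` ⟹
  `SDEC x (ftop (replicate k s)) (flaw (replicate k s))`.

HONEST STATUS.  A k-general sub-family of the open core (tied / exchangeable groups of an arbitrary tree at small gates); `SiblingStep` ⟺ `GateStepN`, `UPartStep`,
`LightResidDECOracle`, `FarTreeRow` remain OPEN; RATE class (log\*) and the honest sentence of `run/shared/lean/prim/quant/README.md` unchanged.  [this work];
nothing here is cited as a published result.  The gluing rows served [cite: KozmaNitzan2024, Conjecture 3 (p. 15)]; product measure [cite: Grimmett1999, §1.3 p. 10].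
-/

noncomputable section

open scoped BigOperators

namespace Summit.CriticalPhenomena.PercolationContinuityZ3.Theorems
namespace Quant
namespace LawDec

open Finset

/-! ### Finset tools for the boosted components -/

section Tools

variable {α : Type*} [DecidableEq α]

/-- product of the boosted openness over a pattern: `Π_{i∈A} (2q if i = j, else q) = q^{|A|}·(2 if j ∈ A, else 1)`. [this work] -/
theorem prod_boost (A : Finset α) (j : α) (q : ℝ) :
    ∏ i ∈ A, (if i = j then 2 * q else q) = q ^ A.card * (if j ∈ A then 2 else 1) := by
  have e : ∀ i ∈ A, (if i = j then 2 * q else q) = q * (if i = j then (2 : ℝ) else 1) := by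
    intro i _; split_ifs <;> ring
  rw [Finset.prod_congr rfl e, Finset.prod_mul_distrib, Finset.prod_const, Finset.prod_ite_eq']

/-- product of the complementary boosted openness: `Π_{i∈T} (1 − o_i) = (1−q)^{|T|}·((1−2q)/(1−q) if j ∈ T, else 1)` (`q ≠ 1`). [this work] -/
theorem prod_one_sub_boost (T : Finset α) (j : α) (q : ℝ) (hq : q ≠ 1) :
    ∏ i ∈ T, (1 - (if i = j then 2 * q else q)) = (1 - q) ^ T.card * (if j ∈ T then (1 - 2 * q) / (1 - q) else 1) := by
  have h1 : (1 : ℝ) - q ≠ 0 := sub_ne_zero.2 (Ne.symm hq)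
  have e : ∀ i ∈ T, (1 - (if i = j then 2 * q else q)) = (1 - q) * (if i = j then (1 - 2 * q) / (1 - q) else 1) := by
    intro i _
    split_ifs
    · field_simp
    · ring
  rw [Finset.prod_congr rfl e, Finset.prod_mul_distrib, Finset.prod_const, Finset.prod_ite_eq']

/-- summing `2` over `A` and `r` over `U ∖ A`. [this work] -/
theorem sum_two_or_r (U A : Finset α) (hAU : A ⊆ U) (r : ℝ) :
    ∑ j ∈ U, (if j ∈ A then (2 : ℝ) else r) = 2 * A.card + ((U \ A).card : ℝ) * r := by
  rw [← Finset.sum_sdiff hAU]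
  have e1 : ∑ j ∈ U \ A, (if j ∈ A then (2 : ℝ) else r) = ∑ j ∈ U \ A, r :=
    Finset.sum_congr rfl fun j hj => by rw [if_neg (Finset.mem_sdiff.1 hj).2]
  have e2 : ∑ j ∈ A, (if j ∈ A then (2 : ℝ) else r) = ∑ j ∈ A, (2 : ℝ) :=
    Finset.sum_congr rfl fun j hj => by rw [if_pos hj]
  rw [e1, e2, Finset.sum_const, Finset.sum_const, nsmul_eq_mul, nsmul_eq_mul]
  ring

end Tools

/-! ### The theorem -/

/-- **`k` IDENTICAL SIBLINGS WITH `(k−1)·q ≤ 1` (every `k ≥ 3`, every sub-tree; SDEC form, given the oracle).**  For a floor `0 < x < 1`, a tree-built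
sibling `s` (`Sib.TreeOK x`), `3 ≤ k`, `(k−1)·s.q ≤ 1`, and the oracle "every tree-built law with fewer than `fgates (replicate k s)` nontrivial gates is SDEC":
the forest of `k` copies of `s` is SDEC at `x`, by the sub-product mixture criterion with the closed-form certificate of the module docstring. [this work] -/
theorem sdec_flaw_replicate_of_subproductMix {x : ℝ} (hx0 : 0 < x) (hx1 : x < 1) (s : Sib) (hs : s.TreeOK x) (k : ℕ) (hk : 3 ≤ k)
    (hkq : ((k : ℝ) - 1) * s.q ≤ 1)
    (hO : ∀ (x' : ℝ) (n' M' : ℕ) (μ' : ℕ → ℝ), n' < fgates (List.replicate k s) → TreeBuiltN x' n' M' μ' → SDEC x' M' μ') :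
    SDEC x (ftop (List.replicate k s)) (flaw (List.replicate k s)) := by
  classical
  have hs' := hs
  obtain ⟨hq0, hq1, hxq, hT, _⟩ := hs
  obtain ⟨hx₁0, hx₁1, _, _, _, _⟩ := hT.lawFacts
  have hm0 : 0 < s.mean := s.mean_pos hs'
  set L : List Sib := List.replicate k s with hLdef
  have hnk : L.length = k := List.length_replicate ..
  have hmem : ∀ t ∈ L, t = s := fun t ht => List.eq_of_mem_replicate ht
  have hL : ∀ t ∈ L, t.TreeOK x := fun t ht => by rw [hmem t ht]; exact hs'
  have hget : ∀ i : Fin L.length, L.get i = s := fun i => hmem _ (List.get_mem L i)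
  have hne : L ≠ [] := by
    intro h; have := congrArg List.length h; rw [hnk] at this; simp at this; omega
  set n : ℕ := L.length with hndef
  set q : ℝ := s.q with hqdef
  -- numeric facts
  have hn3 : (3 : ℝ) ≤ n := by rw [hnk]; exact_mod_cast hk
  have hnq : ((n : ℝ) - 1) * q ≤ 1 := by rw [hnk]; exact hkq
  have hq2 : 2 * q ≤ 1 := by nlinarith
  have hcard : (Finset.univ : Finset (Fin n)).card = n := by rw [Finset.card_univ, Fintype.card_fin]
  have hfm : fmean L = (n : ℝ) * (q * s.mean) := by rw [hLdef, fmean_replicate, hnk]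
  set D : ℝ := ((n : ℝ) - 1) * ((n : ℝ) - 2 * ((n : ℝ) - 1) * q) with hDdef
  have hD1 : 2 ≤ (n : ℝ) - 1 := by linarith
  have hD2 : 1 ≤ (n : ℝ) - 2 * ((n : ℝ) - 1) * q := by nlinarith
  have hD : 0 < D := mul_pos (by linarith) (by linarith)
  -- the certificate data
  set PQ : Finset (Fin n × Fin n) := (Finset.univ : Finset (Fin n × Fin n)).filter fun p => p.1 ≠ p.2 with hPQ
  set PO : Finset (Finset (Fin n)) := (Finset.univ : Finset (Finset (Fin n))).filter fun B => 2 ≤ B.card with hPO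
  set S : Finset ((Fin n × Fin n) ⊕ Finset (Fin n)) := PQ.image Sum.inl ∪ PO.image Sum.inr with hS
  set uO : Finset (Fin n) → ℝ := fun B => if B.card = n then q ^ n
    else q ^ B.card * (1 - q) ^ (n - B.card) * (((B.card : ℝ) - 1) * ((B.card : ℝ) - 2 * ((n : ℝ) - 1) * q)) / D with huO
  set u : (Fin n × Fin n) ⊕ Finset (Fin n) → ℝ := Sum.elim (fun _ => (1 - q) ^ 2 / D) uO with hu
  set E : (Fin n × Fin n) ⊕ Finset (Fin n) → Finset (Fin n) := Sum.elim (fun p => Finset.univ.erase p.1) (fun B => B) with hE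
  set o : (Fin n × Fin n) ⊕ Finset (Fin n) → Fin n → ℝ := Sum.elim (fun p i => if i = p.2 then 2 * q else q) (fun _ _ => 1) with ho
  set v : (Fin n × Fin n) ⊕ Finset (Fin n) → ℝ := Sum.elim (fun _ => q * s.x₁) (fun _ => s.x₁) with hv
  -- membership in `S` and sums over `S`
  have hcase : ∀ c ∈ S, (∃ d j : Fin n, d ≠ j ∧ c = Sum.inl (d, j)) ∨ (∃ B : Finset (Fin n), 2 ≤ B.card ∧ c = Sum.inr B) := by
    intro c hc
    rcases Finset.mem_union.1 hc with h | h
    · obtain ⟨p, hp, rfl⟩ := Finset.mem_image.1 h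
      exact Or.inl ⟨p.1, p.2, (Finset.mem_filter.1 hp).2, rfl⟩
    · obtain ⟨B, hB, rfl⟩ := Finset.mem_image.1 h
      exact Or.inr ⟨B, (Finset.mem_filter.1 hB).2, rfl⟩
  have hsumS : ∀ f : (Fin n × Fin n) ⊕ Finset (Fin n) → ℝ,
      ∑ c ∈ S, f c = ∑ p ∈ PQ, f (Sum.inl p) + ∑ B ∈ PO, f (Sum.inr B) := by
    intro f
    rw [hS, Finset.sum_union, Finset.sum_image (fun a _ b _ h => Sum.inl_injective h),
      Finset.sum_image (fun a _ b _ h => Sum.inr_injective h)]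
    rw [Finset.disjoint_left]
    intro c hc hc'
    obtain ⟨p, _, rfl⟩ := Finset.mem_image.1 hc
    obtain ⟨B, _, h⟩ := Finset.mem_image.1 hc'
    exact Sum.inr_ne_inl h
  -- gated means of the components
  have hmeanQ : ∀ d j : Fin n, d ≠ j → fmean (subRegate L (Finset.univ.erase d) (fun i => if i = j then 2 * q else q)) = (n : ℝ) * (q * s.mean) := by
    intro d j hdj
    rw [fmean_subRegate]
    have e : ∀ i ∈ Finset.univ.erase d, (if i = j then 2 * q else q) * (L.get i).mean
        = q * s.mean + (if i = j then q * s.mean else 0) := by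
      intro i _; rw [hget]; split_ifs <;> ring
    rw [Finset.sum_congr rfl e, Finset.sum_add_distrib, Finset.sum_const, nsmul_eq_mul, Finset.sum_ite_eq',
      if_pos (Finset.mem_erase.2 ⟨Ne.symm hdj, Finset.mem_univ j⟩), Finset.card_erase_of_mem (Finset.mem_univ d), hcard,
      Nat.cast_sub (by omega), Nat.cast_one]
    ring
  have hmeanO : ∀ B : Finset (Fin n), fmean (subRegate L B (fun _ => (1 : ℝ))) = (B.card : ℝ) * s.mean := by
    intro B
    rw [fmean_subRegate_one, Finset.sum_congr rfl fun i _ => (show (L.get i).mean = s.mean by rw [hget i]),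
      Finset.sum_const, nsmul_eq_mul]
  -- weights: nonnegative
  have huO0 : ∀ B : Finset (Fin n), 2 ≤ B.card → 0 ≤ uO B := by
    intro B hB
    show 0 ≤ (if B.card = n then q ^ n
      else q ^ B.card * (1 - q) ^ (n - B.card) * (((B.card : ℝ) - 1) * ((B.card : ℝ) - 2 * ((n : ℝ) - 1) * q)) / D)
    split_ifs
    · positivity
    · have h2 : (2 : ℝ) ≤ B.card := by exact_mod_cast hB
      have ha : 0 ≤ ((B.card : ℝ) - 1) * ((B.card : ℝ) - 2 * ((n : ℝ) - 1) * q) := mul_nonneg (by linarith) (by nlinarith)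
      have hb : 0 ≤ q ^ B.card * (1 - q) ^ (n - B.card) := mul_nonneg (pow_nonneg hq0.le _) (pow_nonneg (by linarith) _)
      exact div_nonneg (mul_nonneg hb ha) hD.le
  refine sdec_flaw_of_subproductMix hx0 hx1 L hL hne hO S u E o ?_ ?_ ?_ ?_ ?_ v ?_ ?_ ?_ ?_
  · -- `0 ≤ u`
    intro c hc
    rcases hcase c hc with ⟨d, j, hdj, rfl⟩ | ⟨B, hB, rfl⟩
    · show 0 ≤ (1 - q) ^ 2 / D; positivity
    · exact huO0 B hB
  · -- `0 < o`
    intro c hc i hi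
    rcases hcase c hc with ⟨d, j, hdj, rfl⟩ | ⟨B, hB, rfl⟩
    · show 0 < (if i = j then 2 * q else q); split_ifs <;> linarith
    · show (0 : ℝ) < 1; exact one_pos
  · -- `o ≤ 1`
    intro c hc i hi
    rcases hcase c hc with ⟨d, j, hdj, rfl⟩ | ⟨B, hB, rfl⟩
    · show (if i = j then 2 * q else q) ≤ 1; split_ifs <;> linarith
    · show (1 : ℝ) ≤ 1; exact le_rfl
  · -- legality
    intro c hc
    rcases hcase c hc with ⟨d, j, hdj, rfl⟩ | ⟨B, hB, rfl⟩
    · exact ⟨d, Or.inl (show d ∉ Finset.univ.erase d from fun h => (Finset.mem_erase.1 h).1 rfl)⟩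
    · exact ⟨⟨0, by omega⟩, Or.inr rfl⟩
  · -- THE PATTERN IDENTITY
    intro A hA
    have hget' : ∀ B : Finset (Fin n),
        ((∏ i ∈ B, (L.get i).q) * ∏ i ∈ Finset.univ \ B, (1 - (L.get i).q)) = q ^ B.card * (1 - q) ^ (n - B.card) := by
      intro B
      rw [Finset.prod_congr rfl fun i _ => (show (L.get i).q = q by rw [hget i]),
        Finset.prod_congr rfl fun i _ => (show 1 - (L.get i).q = 1 - q by rw [hget i]),
        Finset.prod_const, Finset.prod_const, Finset.card_sdiff_of_subset (Finset.subset_univ B), hcard]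
    rw [hget' A, hsumS]
    -- the O part: only `B = A` contributes
    have hOpart : ∑ B ∈ PO, u (Sum.inr B) *
        (if A ⊆ E (Sum.inr B) then (∏ i ∈ A, o (Sum.inr B) i) * ∏ i ∈ E (Sum.inr B) \ A, (1 - o (Sum.inr B) i) else 0)
        = if 2 ≤ A.card then uO A else 0 := by
      have term : ∀ B ∈ PO, u (Sum.inr B) *
          (if A ⊆ E (Sum.inr B) then (∏ i ∈ A, o (Sum.inr B) i) * ∏ i ∈ E (Sum.inr B) \ A, (1 - o (Sum.inr B) i) else 0)
          = if B = A then uO A else 0 := by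
        intro B _
        show uO B * (if A ⊆ B then (∏ i ∈ A, (1 : ℝ)) * ∏ i ∈ B \ A, (1 - (1 : ℝ)) else 0) = _
        by_cases hBA : B = A
        · rw [hBA, if_pos (Finset.Subset.refl A), if_pos rfl, Finset.sdiff_self, Finset.prod_empty, Finset.prod_const_one]
          ring
        · rw [if_neg hBA]
          by_cases hAB : A ⊆ B
          · obtain ⟨i, hi⟩ : (B \ A).Nonempty := by
              rw [Finset.sdiff_nonempty]; intro hBA'; exact hBA (Finset.Subset.antisymm hBA' hAB)
            rw [if_pos hAB, Finset.prod_eq_zero hi (by norm_num), mul_zero, mul_zero]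
          · rw [if_neg hAB, mul_zero]
      rw [Finset.sum_congr rfl term, Finset.sum_ite_eq']
      by_cases h2 : 2 ≤ A.card
      · have hmemA : A ∈ PO := Finset.mem_filter.2 ⟨Finset.mem_univ A, h2⟩
        rw [if_pos hmemA, if_pos h2]
      · have hmemA : A ∉ PO := fun h => h2 (Finset.mem_filter.1 h).2
        rw [if_neg hmemA, if_neg h2]
    rw [hOpart]
    -- the Q part
    have hq1' : q ≠ 1 := ne_of_lt hq1
    set sA : ℕ := A.card with hsA
    set r : ℝ := (1 - 2 * q) / (1 - q) with hrdef
    have hQterm : ∀ p ∈ PQ, u (Sum.inl p) *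
        (if A ⊆ E (Sum.inl p) then (∏ i ∈ A, o (Sum.inl p) i) * ∏ i ∈ E (Sum.inl p) \ A, (1 - o (Sum.inl p) i) else 0)
        = if p.1 ∈ A then 0 else
            (1 - q) ^ 2 / D * (q ^ sA * (1 - q) ^ ((Finset.univ.erase p.1) \ A).card * (if p.2 ∈ A then 2 else r)) := by
      intro p hp
      have hdj : p.1 ≠ p.2 := (Finset.mem_filter.1 hp).2
      show (1 - q) ^ 2 / D * (if A ⊆ Finset.univ.erase p.1 then
          (∏ i ∈ A, (if i = p.2 then 2 * q else q)) * ∏ i ∈ Finset.univ.erase p.1 \ A, (1 - (if i = p.2 then 2 * q else q)) else 0) = _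
      by_cases hd : p.1 ∈ A
      · have hnot : ¬ A ⊆ Finset.univ.erase p.1 := fun h => (Finset.mem_erase.1 (h hd)).1 rfl
        rw [if_neg hnot, if_pos hd, mul_zero]
      · have hsub : A ⊆ Finset.univ.erase p.1 := fun i hi => Finset.mem_erase.2 ⟨fun h => hd (h ▸ hi), Finset.mem_univ i⟩
        rw [if_pos hsub, if_neg hd, prod_boost, prod_one_sub_boost _ _ _ hq1']
        -- `p.2 ∈ A` xor `p.2 ∈ univ.erase p.1 \ A`
        by_cases hj : p.2 ∈ A
        · have hjT : p.2 ∉ Finset.univ.erase p.1 \ A := fun h => (Finset.mem_sdiff.1 h).2 hj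
          rw [if_pos hj, if_neg hjT, if_pos hj]; ring
        · have hjT : p.2 ∈ Finset.univ.erase p.1 \ A :=
            Finset.mem_sdiff.2 ⟨Finset.mem_erase.2 ⟨Ne.symm hdj, Finset.mem_univ _⟩, hj⟩
          rw [if_neg hj, if_pos hjT, if_neg hj]; ring
    rw [Finset.sum_congr rfl hQterm]
    -- sum over `PQ` as a double sum
    have hdouble : ∑ p ∈ PQ, (if p.1 ∈ A then (0 : ℝ) else
          (1 - q) ^ 2 / D * (q ^ sA * (1 - q) ^ ((Finset.univ.erase p.1) \ A).card * (if p.2 ∈ A then 2 else r)))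
        = ∑ d : Fin n, (if d ∈ A then (0 : ℝ) else
          (1 - q) ^ 2 / D * (q ^ sA * (1 - q) ^ ((Finset.univ.erase d) \ A).card * (2 * sA + (((Finset.univ.erase d) \ A).card : ℝ) * r))) := by
      rw [hPQ, Finset.sum_filter, ← Finset.univ_product_univ, Finset.sum_product]
      refine Finset.sum_congr rfl fun d _ => ?_
      by_cases hd : d ∈ A
      · simp only [hd, if_true]
        exact Finset.sum_eq_zero fun j _ => by split_ifs <;> rfl
      · simp only [hd, if_false]
        have hsub : A ⊆ Finset.univ.erase d := fun i hi => Finset.mem_erase.2 ⟨fun h => hd (h ▸ hi), Finset.mem_univ i⟩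
        have e : ∀ j : Fin n, (if d ≠ j then (1 - q) ^ 2 / D * (q ^ sA * (1 - q) ^ ((Finset.univ.erase d) \ A).card *
              (if j ∈ A then 2 else r)) else 0)
            = (1 - q) ^ 2 / D * (q ^ sA * (1 - q) ^ ((Finset.univ.erase d) \ A).card) *
              (if j ∈ Finset.univ.erase d then (if j ∈ A then 2 else r) else 0) := by
          intro j
          by_cases hdj : d = j
          · rw [if_neg (not_not.2 hdj), if_neg (fun h => (Finset.mem_erase.1 h).1 (hdj.symm ▸ rfl))]; ring
          · rw [if_pos hdj, if_pos (Finset.mem_erase.2 ⟨Ne.symm hdj, Finset.mem_univ j⟩)]; ring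
        rw [Finset.sum_congr rfl fun j _ => e j, ← Finset.mul_sum, ← Finset.sum_filter, Finset.filter_mem_eq_inter,
          Finset.univ_inter, sum_two_or_r _ _ hsub r]
        ring
    rw [hdouble]
    -- the summand no longer depends on `d ∉ A`: card of `univ.erase d \ A`
    by_cases hsn : sA = n
    · -- `A = univ`: no Q term, the O term is `q^n`
      have hAu : A = Finset.univ := Finset.eq_univ_of_card A (by rw [← hsA, hsn, Fintype.card_fin])
      have hzero : ∑ d : Fin n, (if d ∈ A then (0 : ℝ) else
          (1 - q) ^ 2 / D * (q ^ sA * (1 - q) ^ ((Finset.univ.erase d) \ A).card * (2 * sA + (((Finset.univ.erase d) \ A).card : ℝ) * r))) = 0 :=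
        Finset.sum_eq_zero fun d _ => by rw [if_pos (hAu ▸ Finset.mem_univ d)]
      have h2n : 2 ≤ A.card := by rw [← hsA, hsn]; omega
      rw [hzero, if_pos h2n, zero_add]
      show (if A.card = n then q ^ n else _) = _
      rw [if_pos (by rw [← hsA]; exact hsn), hsn, Nat.sub_self, pow_zero, mul_one]
    · have hsle : sA ≤ n := by
        have h1 : A.card ≤ Fintype.card (Fin n) := Finset.card_le_univ A
        rw [Fintype.card_fin] at h1
        rw [hsA]; exact h1
      have hslt : sA < n := lt_of_le_of_ne hsle hsn
      have hs1 : 1 ≤ sA := by rw [hsA]; exact Finset.card_pos.2 hA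
      have hT : ∀ d : Fin n, d ∉ A → ((Finset.univ.erase d) \ A).card = n - 1 - sA := by
        intro d hd
        have hsub : A ⊆ Finset.univ.erase d := fun i hi => Finset.mem_erase.2 ⟨fun h => hd (h ▸ hi), Finset.mem_univ i⟩
        rw [Finset.card_sdiff_of_subset hsub, Finset.card_erase_of_mem (Finset.mem_univ d), hcard]
      have e : ∀ d : Fin n, (if d ∈ A then (0 : ℝ) else
          (1 - q) ^ 2 / D * (q ^ sA * (1 - q) ^ ((Finset.univ.erase d) \ A).card * (2 * sA + (((Finset.univ.erase d) \ A).card : ℝ) * r)))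
          = if d ∈ Finset.univ \ A then
            (1 - q) ^ 2 / D * (q ^ sA * (1 - q) ^ (n - 1 - sA) * (2 * sA + ((n - 1 - sA : ℕ) : ℝ) * r)) else 0 := by
        intro d
        by_cases hd : d ∈ A
        · rw [if_pos hd, if_neg (fun h => (Finset.mem_sdiff.1 h).2 hd)]
        · rw [if_neg hd, if_pos (Finset.mem_sdiff.2 ⟨Finset.mem_univ d, hd⟩), hT d hd]
      rw [Finset.sum_congr rfl fun d _ => e d, Finset.sum_ite_mem, Finset.univ_inter, Finset.sum_const,
        Finset.card_sdiff_of_subset (Finset.subset_univ A), hcard, nsmul_eq_mul]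
      -- the O weight at `A`
      have hOA : (if 2 ≤ A.card then uO A else 0)
          = q ^ sA * (1 - q) ^ (n - sA) * (((sA : ℝ) - 1) * ((sA : ℝ) - 2 * ((n : ℝ) - 1) * q)) / D := by
        by_cases h2 : 2 ≤ A.card
        · rw [if_pos h2]
          show (if A.card = n then q ^ n else _) = _
          rw [if_neg (by rw [← hsA]; exact hsn)]
        · rw [if_neg h2]
          have : sA = 1 := by rw [hsA] at hs1 ⊢; omega
          rw [this]; simp
      rw [hOA]
      -- casts and exponents
      have hn1 : 1 ≤ n := by omega
      have ecast1 : ((n - sA : ℕ) : ℝ) = (n : ℝ) - sA := Nat.cast_sub hsle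
      have ecast2 : ((n - 1 - sA : ℕ) : ℝ) = (n : ℝ) - 1 - sA := by
        rw [Nat.sub_sub, Nat.cast_sub (by omega), Nat.cast_add, Nat.cast_one]; ring
      have epow : (1 - q) ^ (n - sA) = (1 - q) ^ (n - 1 - sA) * (1 - q) := by
        rw [← pow_succ]; congr 1; omega
      rw [ecast1, ecast2, epow]
      have h1q : (1 : ℝ) - q ≠ 0 := sub_ne_zero.2 (Ne.symm hq1')
      have hDa : (n : ℝ) - 1 ≠ 0 := by linarith
      have hDb : (n : ℝ) - 2 * ((n : ℝ) - 1) * q ≠ 0 := by linarith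
      have hD' : ((n : ℝ) - 1) * ((n : ℝ) - 2 * ((n : ℝ) - 1) * q) ≠ 0 := mul_ne_zero hDa hDb
      rw [hrdef, hDdef]
      -- clear the denominators by hand (`field_simp` does not recognise the normalised factor)
      have hr2 : (2 * (sA : ℝ) + ((n : ℝ) - 1 - sA) * ((1 - 2 * q) / (1 - q)))
          = (2 * (sA : ℝ) * (1 - q) + ((n : ℝ) - 1 - sA) * (1 - 2 * q)) / (1 - q) := by
        rw [eq_div_iff h1q, add_mul, mul_assoc ((n : ℝ) - 1 - sA), div_mul_cancel₀ _ h1q]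
      rw [hr2, div_mul_eq_mul_div, mul_div_assoc', ← add_div, div_eq_iff hD']
      have e2 : (1 - q) ^ 2 * (q ^ sA * (1 - q) ^ (n - 1 - sA) *
            ((2 * (sA : ℝ) * (1 - q) + ((n : ℝ) - 1 - sA) * (1 - 2 * q)) / (1 - q)))
          = (1 - q) * (q ^ sA * (1 - q) ^ (n - 1 - sA)) * (2 * (sA : ℝ) * (1 - q) + ((n : ℝ) - 1 - sA) * (1 - 2 * q)) := by
        rw [mul_div_assoc', mul_div_assoc', div_eq_iff h1q]; ring
      rw [e2]
      ring
  · -- `0 < v`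
    intro c hc
    rcases hcase c hc with ⟨d, j, hdj, rfl⟩ | ⟨B, hB, rfl⟩
    · show 0 < q * s.x₁; positivity
    · show 0 < s.x₁; exact hx₁0
  · -- `v ≤ o i · x₁`
    intro c hc i hi
    rcases hcase c hc with ⟨d, j, hdj, rfl⟩ | ⟨B, hB, rfl⟩
    · show q * s.x₁ ≤ (if i = j then 2 * q else q) * (L.get i).x₁
      rw [hget]; split_ifs <;> nlinarith
    · show s.x₁ ≤ 1 * (L.get i).x₁
      rw [hget]; linarith
  · -- floors do not bind
    intro c hc
    rcases hcase c hc with ⟨d, j, hdj, rfl⟩ | ⟨B, hB, rfl⟩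
    · show x * fmean (subRegate L (Finset.univ.erase d) (fun i => if i = j then 2 * q else q)) ≤ fmean L * (q * s.x₁)
      rw [hmeanQ d j hdj, hfm]
      have : 0 < (n : ℝ) * (q * s.mean) := by positivity
      nlinarith
    · show x * fmean (subRegate L B (fun _ => (1 : ℝ))) ≤ fmean L * s.x₁
      rw [hmeanO B, hfm]
      have hBn : (B.card : ℝ) ≤ n := by
        have h1 : B.card ≤ Fintype.card (Fin n) := Finset.card_le_univ B
        rw [Fintype.card_fin] at h1
        exact_mod_cast h1
      have h1 : x * (B.card : ℝ) ≤ (n : ℝ) * (q * s.x₁) := by nlinarith [mul_pos hq0 hx₁0]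
      nlinarith
  · -- means dominate
    intro c hc
    rcases hcase c hc with ⟨d, j, hdj, rfl⟩ | ⟨B, hB, rfl⟩
    · show fmean L ≤ fmean (subRegate L (Finset.univ.erase d) (fun i => if i = j then 2 * q else q))
      rw [hmeanQ d j hdj, hfm]
    · show fmean L ≤ fmean (subRegate L B (fun _ => (1 : ℝ)))
      rw [hmeanO B, hfm]
      have h2 : (2 : ℝ) ≤ B.card := by exact_mod_cast hB
      have hnq2 : (n : ℝ) * q ≤ 2 := by nlinarith
      nlinarith

end LawDec
end Quant
end Summit.CriticalPhenomena.PercolationContinuityZ3.Theorems
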